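/-
Copyright: the b2b-balaban T⁴-continuum CRUX team, row NE7b owner lineage `t4-ne7b-p1` (gen 113). Project licence.
-/
import Summits.QuantumFields.BalabanUV.T4Continuum.Spine.NE7b.OneShotChartSupNorm

/-!
# THE ONE-SHOT SECTION IS SMOOTH AT THE BLOCK SCALE AND READS ONLY THE LOCAL COARSE OSCILLATION, IN THE SUP
# CURRENCY: for the scalar `H = G′Q′*(Q′G′Q′*)⁻¹` of [B5] (1.103) on `ℤ^d`, `d ≥ 3`, every side `M = n + 1`, `a > 0`:
# `|H(p+e_μ,y) − H(p,y)| ≤ cHs·M⁻¹·e^{−δ_H|blk p − y|}`, hence `‖∇(H B)‖_∞ ≤ C_∞·M⁻¹·‖B‖_∞` (the `η`-gradient letter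
# `‖∇^η H B‖_∞ ≤ C_∞‖B‖_∞`), and — because `H·1 = 1` — BOTH the value deviation `(HB)(p) − c` and the gradient
# `∇(HB)(p)` are bounded by the exponentially LOCALISED coarse oscillation `Σ′_y e^{−δ_H|blk p − y|}|B(y) − c|`, with the
# two-radius REGION LETTER `ω·K_d(δ_H) + Ω·K_d(δ_H∕2)·e^{−δ_Hρ∕2}` (oscillation `ω` within `ρ` blocks, `Ω` beyond)
# (row NE7b, node U5c; NL-NE7b-1 limbs 1–2 in the sup currency; (46) + `D1BFx/BlockColumnSupNorm` BY NAME; [folklore])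

Cell `pub-balaban`, sub-cell `t4`, spine estimate NE7b (`T4WeightBudget.RelWeightBound`; the cell's OWN estimate — NOT PRINTED
in [Bałaban 1983–89], NOT PROVED).  Crux-route work under `Spine/NE7b/` by the row OWNER (`t4-ne7b-p1` gen 113) under FREEZE
(0)'s crux-prover clause (RULING W-ne7bp1-g113-1, FILING-CLAIM C-ne7bp1-g113-2); NOTHING of Bałaban's is asserted; no
`T4Continuum/Support` leaf typed; no `def`; zero `sorry`.  Imports (BY NAME): (46) `OneShotChartSupNorm` (row letters, `ℓ^∞` action)
and through it the β-team's `D1BFx/BlockColumnSupNorm` (`abs_gq_diff_le_sup`: the mesh-free GRADIENT leg of the block columns,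
`|(G′Q′*)(p+e_μ,y′) − (G′Q′*)(p,y′)| ≤ cG·(n+1)⁻¹·e^{−δ_u|blk p − y′|}`; `abs_tsum_mul_le_of_decay`; `abs_kerH_le_sup`) and the
Literature columns `B5Hk103ScalarZd` (`kerH`, `Kinv`, `tsum_kerH_row`), `B5Hk165L2Zd` (`HBZd`).

WHY (located).  Print's small-field REGIONS are pointwise conditions on fields and their lattice derivatives ((A3); [B5] (1.65):
`|H_k(x,y)|, |∂H_k(x,y)| ≤ O(1)e^{−δ|x−y|}`; Dimock I Lemma 31).  (46) typed the VALUE half in the sup currency for the scalar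
one-shot section (`‖H_M‖_{∞→∞} ≤ C_∞` for every side); the hard-step cell's region junction (PRICING-NE7b v121 F721 (iii), second
branch: «an `ℓ²` ball … forces `r ≈ |Λ|^{1∕2}·p(g)` — volume-size») needs the INTENSIVE form: the fine configuration `H B` and its
`η`-derivatives at a point are controlled by the coarse datum NEAR that point, with NO volume factor.  The β-team's gradient leg
`abs_gq_diff_le_sup` composed with `(Q′G′Q′*)⁻¹`'s decay (`abs_Kinv_le`) gives the gradient kernel bound with one factor `M⁻¹`
(§1); Young's bookkeeping gives `‖∇(HB)‖_∞ ≤ C_∞M⁻¹‖B‖_∞` (§2); and since every row of `H` sums to one (`tsum_kerH_row`), `B`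
may be replaced by `B − c` for any constant `c` in both the value deviation and the gradient (§3) — so a coarse field that is
FLAT NEAR `blk p` produces a fine section that is close to that constant and has small `η`-gradient at `p`, up to an
exponentially small tail read from the global bound (§4, the two-radius letter).  Bookkeeping only; the analysis is pv23's
(`PoissonInterior`) and the β-team's.

WHAT IS PROVED ([folklore]; `n : ℕ`, `a > 0`, `d ≥ 3` where marked; `e μ` the unit vector, `blk` the block map):
* §1 `kerH_diff_eq_tsum` (every `d`), **`abs_kerH_diff_le_sup`** (`d ≥ 3`: `|H(p+e_μ,y) − H(p,y)| ≤ cHs(d,a)·(n+1)⁻¹·e^{−δ_H|blk p−y|}`),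
  `summable_abs_kerH_diff_row`, **`tsum_abs_kerH_diff_le_sup`** (`Σ′_y|H(p+e_μ,y) − H(p,y)| ≤ cHs·(n+1)⁻¹·K_d(δ_H)`),
  `summable_kerH_row`, `tsum_kerH_diff_row` (every `d`: `Σ′_y (H(p+e_μ,y) − H(p,y)) = 0`).
* §2 `HBZd_diff_eq` (every `d`, bounded `B`), **`abs_HBZd_diff_le_sup`** (`d ≥ 3`: `|(HB)(p+e_μ) − (HB)(p)| ≤ cHs·(n+1)⁻¹·K_d(δ_H)·R`
  for `|B| ≤ R` — **`‖∇(H_M B)‖_∞ ≤ C_∞·M⁻¹·‖B‖_∞`**).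
* §3 `HBZd_sub_const_eq` (every `d`: `(HB)(p) − c = Σ′_y (B(y) − c)H(p,y)`), **`abs_HBZd_sub_const_le_osc`** (`d ≥ 3`:
  `|(HB)(p) − c| ≤ cHs·Σ′_y e^{−δ_H|blk p−y|}|B(y) − c|`), `HBZd_diff_eq_osc`, **`abs_HBZd_diff_le_osc`** (`d ≥ 3`:
  `|(HB)(p+e_μ) − (HB)(p)| ≤ cHs·(n+1)⁻¹·Σ′_y e^{−δ_H|blk p−y|}|B(y) − c|`).
* §4 `exp_osc_le_two_radius` (pointwise split), **`tsum_exp_osc_le_two_radius`** (`|B(y) − c| ≤ ω` for `|blk p − y| ≤ ρ`, `≤ Ω`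
  everywhere ⟹ `Σ′_y e^{−δ|blk p−y|}|B(y) − c| ≤ ω·K_d(δ) + Ω·e^{−δρ∕2}·K_d(δ∕2)`), **`abs_HBZd_sub_const_le_two_radius`** and
  **`abs_HBZd_diff_le_two_radius`** (`d ≥ 3`: THE REGION LETTERS — value deviation `≤ cHs·(ωK_d(δ_H) + Ωe^{−δ_Hρ∕2}K_d(δ_H∕2))`,
  gradient the same times `(n+1)⁻¹`).
* §5 toy.

HONEST (what this is NOT).  Constants EXISTENTIAL in `d` and useless by value (as (46)); forward differences only (a backward form
costs a factor `e`, `BlockColumnSupNorm.abs_gq_diff_sub_le_sup`; second differences would need third differences of the lattice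
Green function — not in the tree); scalar `ℤ^d` object, no torus, nothing of the covariant `H_k` ∕ axial gauge ((A3), NC-NE7b-α
UNRULED), no identification of `ω, Ω, ρ` with print's `p(g)`-windows.  BY-NAME EFFECT ON THE WALL: NONE — the sup-currency letters
of the Gaussian one-shot section (value, gradient, localisation) are typed; `RelWeightBound` untouched.  NE7b NOT PRINTED ∕ NOT
PROVED; spine PROVED 0∕9; rung (B)+1 on a FINITE torus — NOT infinite volume, NOT the mass gap, NOT Clay.  HONEST DEPENDENCY:
continuum YM on T⁴ ⇐ BetaPertH ∧ nine spine estimates (0∕9 proved); BetaPertH ⇐ (D1) ∧ (D4) ∧ CAP+tail; G-an2-4 gates asym, D1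
and NE2∕3∕4.
-/

set_option autoImplicit false

namespace Summit.QuantumFields.BalabanUV.T4Continuum.NE7b.OneShotChartSupGradient

open Literature.MathematicalPhysics.QuantumFieldTheory.Balaban1983to89
open B4Sect5Proof (latticeConst latticeConst_nonneg)
open B6QGQLower276 (X e blk)
open B6QGQDecay237 (deltaU deltaU_pos cInv cInv_pos deltaInv deltaInv_pos)
open B5Hk103ScalarZd (kerH gq Kinv summable_kerH abs_Kinv_le summable_expX tsum_expX_le deltaH deltaH_pos tsum_kerH_row)
open B5Hk165L2Zd (HBZd)
open Summit.QuantumFields.BalabanUV.Beta.D1BFx.BlockColumnSupNorm (cG cG_pos cHs cHs_nonneg abs_gq_diff_le_sup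
  abs_tsum_mul_le_of_decay abs_kerH_le_sup)
open OneShotChartSupNorm (summable_abs_kerH_row summable_HBZd_of_bounded nonneg_of_abs_le)

noncomputable section

variable {d : ℕ}

/-! ## §1. The gradient of the kernel: one factor of the mesh, no volume factor -/

/-- The forward difference of `H(·,y)` as a series over the block columns' differences (every `d`). [folklore] -/
theorem kerH_diff_eq_tsum (n : ℕ) {a : ℝ} (ha : 0 < a) (p y : X d) (μ : Fin d) :
    kerH n a (p + e μ) y - kerH n a p y = ∑' y' : X d, (gq n a (p + e μ) y' - gq n a p y') * Kinv n a y' y := by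
  rw [kerH, kerH, ← (summable_kerH n ha (p + e μ) y).tsum_sub (summable_kerH n ha p y)]
  exact tsum_congr fun y' => by ring

/-- **THE GRADIENT KERNEL LETTER** (`d ≥ 3`): `|H(p+e_μ,y) − H(p,y)| ≤ cHs(d,a)·(n+1)⁻¹·e^{−δ_H|blk p − y|_∞}` — the β-team's
gradient leg `abs_gq_diff_le_sup` convolved with `(Q′G′Q′*)⁻¹`'s decay; ONE factor of the mesh `(n+1)⁻¹`, NO volume factor. [folklore] -/
theorem abs_kerH_diff_le_sup (hd : 3 ≤ d) (n : ℕ) {a : ℝ} (ha : 0 < a) (p y : X d) (μ : Fin d) :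
    |kerH n a (p + e μ) y - kerH n a p y|
      ≤ cHs d a / ((n : ℝ) + 1) * Real.exp (-(deltaH d a * dist (blk n p) y)) := by
  rw [kerH_diff_eq_tsum n ha p y μ]
  have hA : 0 ≤ cG d a / ((n : ℝ) + 1) := div_nonneg (cG_pos d ha).le (by positivity)
  have h := abs_tsum_mul_le_of_decay (deltaU_pos d ha) (deltaInv_pos d ha) hA (cInv_pos d ha).le (blk n p) y
    (fun y' => abs_gq_diff_le_sup hd n ha p y' μ) (fun y' => abs_Kinv_le n ha y' y)
  calc _ ≤ _ := h
    _ = cHs d a / ((n : ℝ) + 1) * Real.exp (-(deltaH d a * dist (blk n p) y)) := by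
        rw [cHs, deltaH]; ring

/-- The gradient row `y ↦ |H(p+e_μ,y) − H(p,y)|` is summable (every `d`). [folklore] -/
theorem summable_abs_kerH_diff_row (n : ℕ) {a : ℝ} (ha : 0 < a) (p : X d) (μ : Fin d) :
    Summable fun y : X d => |kerH n a (p + e μ) y - kerH n a p y| := by
  refine Summable.of_nonneg_of_le (fun y => abs_nonneg _) (fun y => abs_sub _ _)
    ((summable_abs_kerH_row n ha (p + e μ)).add (summable_abs_kerH_row n ha p))

/-- **THE GRADIENT ROW LETTER** (`d ≥ 3`): `Σ′_y |H(p+e_μ,y) − H(p,y)| ≤ cHs(d,a)·(n+1)⁻¹·K_d(δ_H)`. [folklore] -/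
theorem tsum_abs_kerH_diff_le_sup (hd : 3 ≤ d) (n : ℕ) {a : ℝ} (ha : 0 < a) (p : X d) (μ : Fin d) :
    ∑' y : X d, |kerH n a (p + e μ) y - kerH n a p y|
      ≤ cHs d a / ((n : ℝ) + 1) * latticeConst d (deltaH d a) := by
  have hA : 0 ≤ cHs d a / ((n : ℝ) + 1) := div_nonneg (cHs_nonneg d ha) (by positivity)
  have hmaj : Summable fun y : X d => cHs d a / ((n : ℝ) + 1) * Real.exp (-(deltaH d a * dist (blk n p) y)) :=
    (summable_expX (deltaH_pos d ha) (blk n p)).mul_left _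
  calc ∑' y : X d, |kerH n a (p + e μ) y - kerH n a p y|
      ≤ ∑' y : X d, cHs d a / ((n : ℝ) + 1) * Real.exp (-(deltaH d a * dist (blk n p) y)) :=
        Summable.tsum_le_tsum (fun y => abs_kerH_diff_le_sup hd n ha p y μ)
          (summable_abs_kerH_diff_row n ha p μ) hmaj
    _ = cHs d a / ((n : ℝ) + 1) * ∑' y : X d, Real.exp (-(deltaH d a * dist (blk n p) y)) := tsum_mul_left
    _ ≤ cHs d a / ((n : ℝ) + 1) * latticeConst d (deltaH d a) :=
        mul_le_mul_of_nonneg_left (tsum_expX_le (deltaH_pos d ha) (blk n p)) hA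

/-- The row `y ↦ H(p,y)` itself is summable (every `d`). [folklore] -/
theorem summable_kerH_row (n : ℕ) {a : ℝ} (ha : 0 < a) (p : X d) : Summable fun y : X d => kerH n a p y :=
  Summable.of_norm (by simpa only [Real.norm_eq_abs] using summable_abs_kerH_row n ha p)

/-- `Σ′_y (H(p+e_μ,y) − H(p,y)) = 0` (every `d`): both rows sum to one (`H·1 = 1`). [folklore] -/
theorem tsum_kerH_diff_row (n : ℕ) {a : ℝ} (ha : 0 < a) (p : X d) (μ : Fin d) :
    ∑' y : X d, (kerH n a (p + e μ) y - kerH n a p y) = 0 := by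
  rw [(summable_kerH_row n ha (p + e μ)).tsum_sub (summable_kerH_row n ha p), tsum_kerH_row n ha, tsum_kerH_row n ha,
    sub_self]

/-! ## §2. The gradient of the section on bounded coarse data: `‖∇(H_M B)‖_∞ ≤ C_∞·M⁻¹·‖B‖_∞` -/

/-- `(HB)(p+e_μ) − (HB)(p) = Σ′_y B(y)(H(p+e_μ,y) − H(p,y))` for bounded `B` (every `d`). [folklore] -/
theorem HBZd_diff_eq (n : ℕ) {a : ℝ} (ha : 0 < a) {Bf : X d → ℝ} {R : ℝ} (hB : ∀ y, |Bf y| ≤ R) (p : X d) (μ : Fin d) :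
    HBZd n a Bf (p + e μ) - HBZd n a Bf p = ∑' y : X d, Bf y * (kerH n a (p + e μ) y - kerH n a p y) := by
  rw [HBZd, HBZd, ← (summable_HBZd_of_bounded n ha hB (p + e μ)).tsum_sub (summable_HBZd_of_bounded n ha hB p)]
  exact tsum_congr fun y => by ring

/-- **THE GRADIENT LETTER** (`d ≥ 3`): `|(HB)(p+e_μ) − (HB)(p)| ≤ cHs(d,a)·(n+1)⁻¹·K_d(δ_H)·R` for `|B| ≤ R` — in `η`-units
`‖∇^η(H B)‖_∞ ≤ C_∞(d,a)·‖B‖_∞` for EVERY side, the derivative half of [B5] (1.65)'s shape for the scalar one-shot section. [folklore] -/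
theorem abs_HBZd_diff_le_sup (hd : 3 ≤ d) (n : ℕ) {a : ℝ} (ha : 0 < a) {Bf : X d → ℝ} {R : ℝ} (hB : ∀ y, |Bf y| ≤ R)
    (p : X d) (μ : Fin d) :
    |HBZd n a Bf (p + e μ) - HBZd n a Bf p| ≤ cHs d a / ((n : ℝ) + 1) * latticeConst d (deltaH d a) * R := by
  have hR : 0 ≤ R := nonneg_of_abs_le hB
  rw [HBZd_diff_eq n ha hB p μ]
  have hsum : HasSum (fun y : X d => R * |kerH n a (p + e μ) y - kerH n a p y|)
      (R * ∑' y : X d, |kerH n a (p + e μ) y - kerH n a p y|) :=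
    (summable_abs_kerH_diff_row n ha p μ).hasSum.mul_left R
  have h := tsum_of_norm_bounded hsum fun y => by
    rw [Real.norm_eq_abs, abs_mul]
    exact mul_le_mul_of_nonneg_right (hB y) (abs_nonneg _)
  rw [Real.norm_eq_abs] at h
  calc _ ≤ R * ∑' y : X d, |kerH n a (p + e μ) y - kerH n a p y| := h
    _ ≤ R * (cHs d a / ((n : ℝ) + 1) * latticeConst d (deltaH d a)) :=
        mul_le_mul_of_nonneg_left (tsum_abs_kerH_diff_le_sup hd n ha p μ) hR
    _ = _ := by ring

/-! ## §3. `H·1 = 1`: the section reads only the coarse OSCILLATION, exponentially localised -/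

/-- `(HB)(p) − c = Σ′_y (B(y) − c)·H(p,y)` for every constant `c` and bounded `B` (every `d`; `Σ′_y H(p,y) = 1`). [folklore] -/
theorem HBZd_sub_const_eq (n : ℕ) {a : ℝ} (ha : 0 < a) {Bf : X d → ℝ} {R : ℝ} (hB : ∀ y, |Bf y| ≤ R) (p : X d) (c : ℝ) :
    HBZd n a Bf p - c = ∑' y : X d, (Bf y - c) * kerH n a p y := by
  calc HBZd n a Bf p - c = (∑' y : X d, Bf y * kerH n a p y) - ∑' y : X d, c * kerH n a p y := by
        rw [HBZd, tsum_mul_left, tsum_kerH_row n ha, mul_one]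
    _ = ∑' y : X d, (Bf y * kerH n a p y - c * kerH n a p y) :=
        ((summable_HBZd_of_bounded n ha hB p).tsum_sub ((summable_kerH_row n ha p).mul_left c)).symm
    _ = ∑' y : X d, (Bf y - c) * kerH n a p y := tsum_congr fun y => by ring

/-- A bound `|B| ≤ R` and a constant `c` give the crude oscillation bound `|B(y) − c| ≤ R + |c|`. [folklore] -/
theorem abs_sub_const_le {Bf : X d → ℝ} {R : ℝ} (hB : ∀ y, |Bf y| ≤ R) (c : ℝ) (y : X d) : |Bf y - c| ≤ R + |c| :=
  (abs_sub _ _).trans (add_le_add (hB y) le_rfl)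

/-- The localised oscillation series converges (every `d`). [folklore] -/
theorem summable_exp_mul_osc (n : ℕ) {a : ℝ} (ha : 0 < a) {Bf : X d → ℝ} {R : ℝ} (hB : ∀ y, |Bf y| ≤ R) (p : X d)
    (c : ℝ) : Summable fun y : X d => Real.exp (-(deltaH d a * dist (blk n p) y)) * |Bf y - c| := by
  refine Summable.of_norm_bounded ((summable_expX (deltaH_pos d ha) (blk n p)).mul_right (R + |c|)) fun y => ?_
  rw [Real.norm_eq_abs, abs_mul, abs_abs, abs_of_pos (Real.exp_pos _)]
  exact mul_le_mul_of_nonneg_left (abs_sub_const_le hB c y) (Real.exp_pos _).le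

/-- **THE LOCALISED VALUE LETTER** (`d ≥ 3`): `|(HB)(p) − c| ≤ cHs(d,a)·Σ′_y e^{−δ_H|blk p − y|_∞}|B(y) − c|` for every constant
`c` — the section deviates from `c` at `p` only by the exponentially localised coarse oscillation about `c`. [folklore] -/
theorem abs_HBZd_sub_const_le_osc (hd : 3 ≤ d) (n : ℕ) {a : ℝ} (ha : 0 < a) {Bf : X d → ℝ} {R : ℝ}
    (hB : ∀ y, |Bf y| ≤ R) (p : X d) (c : ℝ) :
    |HBZd n a Bf p - c| ≤ cHs d a * ∑' y : X d, Real.exp (-(deltaH d a * dist (blk n p) y)) * |Bf y - c| := by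
  rw [HBZd_sub_const_eq n ha hB p c]
  have hsum : HasSum (fun y : X d => cHs d a * (Real.exp (-(deltaH d a * dist (blk n p) y)) * |Bf y - c|))
      (cHs d a * ∑' y : X d, Real.exp (-(deltaH d a * dist (blk n p) y)) * |Bf y - c|) :=
    (summable_exp_mul_osc n ha hB p c).hasSum.mul_left _
  have hpt : ∀ y : X d,
      ‖(Bf y - c) * kerH n a p y‖ ≤ cHs d a * (Real.exp (-(deltaH d a * dist (blk n p) y)) * |Bf y - c|) := by
    intro y
    rw [Real.norm_eq_abs, abs_mul]
    calc |Bf y - c| * |kerH n a p y| ≤ |Bf y - c| * (cHs d a * Real.exp (-(deltaH d a * dist (blk n p) y))) :=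
          mul_le_mul_of_nonneg_left (abs_kerH_le_sup hd n ha p y) (abs_nonneg _)
      _ = _ := by ring
  have h := tsum_of_norm_bounded hsum hpt
  rw [Real.norm_eq_abs] at h
  exact h

/-- `(HB)(p+e_μ) − (HB)(p) = Σ′_y (B(y) − c)(H(p+e_μ,y) − H(p,y))` for every constant `c` (every `d`). [folklore] -/
theorem HBZd_diff_eq_osc (n : ℕ) {a : ℝ} (ha : 0 < a) {Bf : X d → ℝ} {R : ℝ} (hB : ∀ y, |Bf y| ≤ R) (p : X d)
    (μ : Fin d) (c : ℝ) :
    HBZd n a Bf (p + e μ) - HBZd n a Bf p = ∑' y : X d, (Bf y - c) * (kerH n a (p + e μ) y - kerH n a p y) := by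
  have h0 : ∑' y : X d, c * (kerH n a (p + e μ) y - kerH n a p y) = 0 := by
    rw [tsum_mul_left, tsum_kerH_diff_row n ha p μ, mul_zero]
  have hs1 : Summable fun y : X d => Bf y * (kerH n a (p + e μ) y - kerH n a p y) := by
    refine Summable.of_norm_bounded ((summable_abs_kerH_diff_row n ha p μ).mul_left R) fun y => ?_
    rw [Real.norm_eq_abs, abs_mul]
    exact mul_le_mul_of_nonneg_right (hB y) (abs_nonneg _)
  have hs2 : Summable fun y : X d => c * (kerH n a (p + e μ) y - kerH n a p y) :=
    ((summable_kerH_row n ha (p + e μ)).sub (summable_kerH_row n ha p)).mul_left c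
  rw [HBZd_diff_eq n ha hB p μ, ← sub_zero (∑' y : X d, Bf y * (kerH n a (p + e μ) y - kerH n a p y)), ← h0,
    ← hs1.tsum_sub hs2]
  exact tsum_congr fun y => by ring

/-- **THE LOCALISED GRADIENT LETTER** (`d ≥ 3`): `|(HB)(p+e_μ) − (HB)(p)| ≤ cHs(d,a)·(n+1)⁻¹·Σ′_y e^{−δ_H|blk p − y|_∞}|B(y) − c|`
for every constant `c` — the fine gradient at `p` is the mesh times the exponentially localised coarse oscillation. [folklore] -/
theorem abs_HBZd_diff_le_osc (hd : 3 ≤ d) (n : ℕ) {a : ℝ} (ha : 0 < a) {Bf : X d → ℝ} {R : ℝ} (hB : ∀ y, |Bf y| ≤ R)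
    (p : X d) (μ : Fin d) (c : ℝ) :
    |HBZd n a Bf (p + e μ) - HBZd n a Bf p|
      ≤ cHs d a / ((n : ℝ) + 1) * ∑' y : X d, Real.exp (-(deltaH d a * dist (blk n p) y)) * |Bf y - c| := by
  rw [HBZd_diff_eq_osc n ha hB p μ c]
  have hsum : HasSum
      (fun y : X d => cHs d a / ((n : ℝ) + 1) * (Real.exp (-(deltaH d a * dist (blk n p) y)) * |Bf y - c|))
      (cHs d a / ((n : ℝ) + 1) * ∑' y : X d, Real.exp (-(deltaH d a * dist (blk n p) y)) * |Bf y - c|) :=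
    (summable_exp_mul_osc n ha hB p c).hasSum.mul_left _
  have hpt : ∀ y : X d, ‖(Bf y - c) * (kerH n a (p + e μ) y - kerH n a p y)‖
      ≤ cHs d a / ((n : ℝ) + 1) * (Real.exp (-(deltaH d a * dist (blk n p) y)) * |Bf y - c|) := by
    intro y
    rw [Real.norm_eq_abs, abs_mul]
    calc |Bf y - c| * |kerH n a (p + e μ) y - kerH n a p y|
        ≤ |Bf y - c| * (cHs d a / ((n : ℝ) + 1) * Real.exp (-(deltaH d a * dist (blk n p) y))) :=
          mul_le_mul_of_nonneg_left (abs_kerH_diff_le_sup hd n ha p y μ) (abs_nonneg _)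
      _ = _ := by ring
  have h := tsum_of_norm_bounded hsum hpt
  rw [Real.norm_eq_abs] at h
  exact h

/-! ## §4. The two-radius region letter: local oscillation `ω` within `ρ` blocks, global oscillation `Ω` beyond -/

/-- Pointwise split of the weight: if `|B(y) − c| ≤ ω` whenever `|blk p − y|_∞ ≤ ρ` and `|B(y) − c| ≤ Ω` always (`0 ≤ ω, Ω`), then
`e^{−δD}|B(y) − c| ≤ ω·e^{−δD} + Ω·e^{−δρ∕2}·e^{−(δ∕2)D}` with `D = |blk p − y|_∞` (`δ ≥ 0`). [folklore] -/
theorem exp_osc_le_two_radius {δ ρ ω Ω D v : ℝ} (hδ : 0 ≤ δ) (hω : 0 ≤ ω) (hΩ : 0 ≤ Ω)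
    (hloc : D ≤ ρ → |v| ≤ ω) (hglob : |v| ≤ Ω) :
    Real.exp (-(δ * D)) * |v| ≤ ω * Real.exp (-(δ * D)) + Ω * (Real.exp (-(δ * ρ / 2)) * Real.exp (-(δ / 2 * D))) := by
  have he : 0 < Real.exp (-(δ * D)) := Real.exp_pos _
  have h2 : 0 ≤ Ω * (Real.exp (-(δ * ρ / 2)) * Real.exp (-(δ / 2 * D))) := by positivity
  by_cases hDρ : D ≤ ρ
  · have h1 : Real.exp (-(δ * D)) * |v| ≤ ω * Real.exp (-(δ * D)) := by
      rw [mul_comm]; exact mul_le_mul_of_nonneg_right (hloc hDρ) he.le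
    linarith
  · rw [not_le] at hDρ
    have hsplit : Real.exp (-(δ * D)) ≤ Real.exp (-(δ * ρ / 2)) * Real.exp (-(δ / 2 * D)) := by
      rw [← Real.exp_add]
      exact Real.exp_le_exp.2 (by nlinarith)
    have h1 : Real.exp (-(δ * D)) * |v| ≤ Ω * (Real.exp (-(δ * ρ / 2)) * Real.exp (-(δ / 2 * D))) := by
      calc Real.exp (-(δ * D)) * |v| ≤ (Real.exp (-(δ * ρ / 2)) * Real.exp (-(δ / 2 * D))) * Ω :=
            mul_le_mul hsplit hglob (abs_nonneg _) (by positivity)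
        _ = _ := by ring
    have h3 : 0 ≤ ω * Real.exp (-(δ * D)) := by positivity
    linarith

/-- **The two-radius oscillation sum**: under the same hypotheses (`δ > 0`),
`Σ′_y e^{−δ|blk p − y|}|B(y) − c| ≤ ω·K_d(δ) + Ω·e^{−δρ∕2}·K_d(δ∕2)`. [folklore] -/
theorem tsum_exp_osc_le_two_radius {δ ρ ω Ω : ℝ} (hδ : 0 < δ) (hω : 0 ≤ ω) (hΩ : 0 ≤ Ω) (x : X d) {g : X d → ℝ}
    (hloc : ∀ y, dist x y ≤ ρ → |g y| ≤ ω) (hglob : ∀ y, |g y| ≤ Ω) :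
    ∑' y : X d, Real.exp (-(δ * dist x y)) * |g y|
      ≤ ω * latticeConst d δ + Ω * Real.exp (-(δ * ρ / 2)) * latticeConst d (δ / 2) := by
  have hS1 : Summable fun y : X d => ω * Real.exp (-(δ * dist x y)) := (summable_expX hδ x).mul_left ω
  have hS2 : Summable fun y : X d => Ω * (Real.exp (-(δ * ρ / 2)) * Real.exp (-(δ / 2 * dist x y))) :=
    ((summable_expX (half_pos hδ) x).mul_left _).mul_left Ω
  have hpt : ∀ y : X d, Real.exp (-(δ * dist x y)) * |g y|
      ≤ ω * Real.exp (-(δ * dist x y)) + Ω * (Real.exp (-(δ * ρ / 2)) * Real.exp (-(δ / 2 * dist x y))) :=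
    fun y => exp_osc_le_two_radius hδ.le hω hΩ (hloc y) (hglob y)
  have hS0 : Summable fun y : X d => Real.exp (-(δ * dist x y)) * |g y| :=
    Summable.of_nonneg_of_le (fun y => by positivity) hpt (hS1.add hS2)
  calc ∑' y : X d, Real.exp (-(δ * dist x y)) * |g y|
      ≤ ∑' y : X d, (ω * Real.exp (-(δ * dist x y)) + Ω * (Real.exp (-(δ * ρ / 2)) * Real.exp (-(δ / 2 * dist x y)))) :=
        Summable.tsum_le_tsum hpt hS0 (hS1.add hS2)
    _ = ω * ∑' y : X d, Real.exp (-(δ * dist x y))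
          + Ω * (Real.exp (-(δ * ρ / 2)) * ∑' y : X d, Real.exp (-(δ / 2 * dist x y))) := by
        rw [hS1.tsum_add hS2, tsum_mul_left, tsum_mul_left, tsum_mul_left]
    _ ≤ ω * latticeConst d δ + Ω * (Real.exp (-(δ * ρ / 2)) * latticeConst d (δ / 2)) := by
        gcongr
        · exact tsum_expX_le hδ x
        · exact tsum_expX_le (half_pos hδ) x
    _ = _ := by ring

/-- **THE REGION LETTER FOR THE VALUE** (`d ≥ 3`): if the coarse field stays within `ω` of `c` on the blocks within `ρ` of `blk p`
and within `Ω` of `c` everywhere, then `|(HB)(p) − c| ≤ cHs(d,a)·(ω·K_d(δ_H) + Ω·e^{−δ_Hρ∕2}·K_d(δ_H∕2))` — intensive, NO volume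
factor. [folklore] -/
theorem abs_HBZd_sub_const_le_two_radius (hd : 3 ≤ d) (n : ℕ) {a : ℝ} (ha : 0 < a) {Bf : X d → ℝ} {R : ℝ}
    (hB : ∀ y, |Bf y| ≤ R) (p : X d) (c : ℝ) {ρ ω Ω : ℝ} (hω : 0 ≤ ω) (hΩ : 0 ≤ Ω)
    (hloc : ∀ y, dist (blk n p) y ≤ ρ → |Bf y - c| ≤ ω) (hglob : ∀ y, |Bf y - c| ≤ Ω) :
    |HBZd n a Bf p - c|
      ≤ cHs d a * (ω * latticeConst d (deltaH d a)
          + Ω * Real.exp (-(deltaH d a * ρ / 2)) * latticeConst d (deltaH d a / 2)) :=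
  (abs_HBZd_sub_const_le_osc hd n ha hB p c).trans
    (mul_le_mul_of_nonneg_left (tsum_exp_osc_le_two_radius (deltaH_pos d ha) hω hΩ (blk n p) hloc hglob)
      (cHs_nonneg d ha))

/-- **THE REGION LETTER FOR THE GRADIENT** (`d ≥ 3`): under the same hypotheses,
`|(HB)(p+e_μ) − (HB)(p)| ≤ cHs(d,a)·(n+1)⁻¹·(ω·K_d(δ_H) + Ω·e^{−δ_Hρ∕2}·K_d(δ_H∕2))` — a coarse field flat to `ω` near `blk p`
produces a fine section with `η`-gradient `≤ C(ω + Ωe^{−δ_Hρ∕2})` there. [folklore] -/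
theorem abs_HBZd_diff_le_two_radius (hd : 3 ≤ d) (n : ℕ) {a : ℝ} (ha : 0 < a) {Bf : X d → ℝ} {R : ℝ}
    (hB : ∀ y, |Bf y| ≤ R) (p : X d) (μ : Fin d) (c : ℝ) {ρ ω Ω : ℝ} (hω : 0 ≤ ω) (hΩ : 0 ≤ Ω)
    (hloc : ∀ y, dist (blk n p) y ≤ ρ → |Bf y - c| ≤ ω) (hglob : ∀ y, |Bf y - c| ≤ Ω) :
    |HBZd n a Bf (p + e μ) - HBZd n a Bf p|
      ≤ cHs d a / ((n : ℝ) + 1) * (ω * latticeConst d (deltaH d a)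
          + Ω * Real.exp (-(deltaH d a * ρ / 2)) * latticeConst d (deltaH d a / 2)) :=
  (abs_HBZd_diff_le_osc hd n ha hB p μ c).trans
    (mul_le_mul_of_nonneg_left (tsum_exp_osc_le_two_radius (deltaH_pos d ha) hω hΩ (blk n p) hloc hglob)
      (div_nonneg (cHs_nonneg d ha) (by positivity)))

/-! ## §5. Toy -/

/-- Toy (the two-radius split at one point): `δ = 2`, `ρ = 1`, `D = 3 > ρ`, `ω = 0`, `Ω = 1`, `|v| = 1`:
`e^{−6}·1 ≤ 0 + 1·e^{−1}·e^{−3}`. -/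
example : Real.exp (-(2 * 3)) * |(1 : ℝ)| ≤ 0 * Real.exp (-(2 * 3)) + 1 * (Real.exp (-(2 * 1 / 2)) * Real.exp (-(2 / 2 * 3))) :=
  exp_osc_le_two_radius (by norm_num) le_rfl zero_le_one (fun h => by norm_num at h) (by simp)

end

end Summit.QuantumFields.BalabanUV.T4Continuum.NE7b.OneShotChartSupGradient
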